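/-
Copyright (c) 2026. All rights reserved.
Released under Apache 2.0 license as described in the file LICENSE.
Authors: abc-iut cell, seat abc-iut-w5-d006 (gen 4).
-/
import Literature.GroupTheory.ProPStronglyComplete
import Literature.GroupTheory.ProPPowerMap
import Mathlib.Topology.Algebra.ClopenNhdofOne
import Mathlib.Topology.Algebra.OpenSubgroup
import Mathlib.Topology.Algebra.Group.Quotient
import Mathlib.GroupTheory.Commutator.Basic
import Mathlib.GroupTheory.Index
import Mathlib.GroupTheory.PGroup

/-!
# Strong completeness relative to a closed normal subgroup: dévissage, the abelian layer, and the
# central-series reduction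

A profinite group is *strongly complete* when every subgroup of finite index is open (Nikolov–Segal prove
this for all topologically finitely generated profinite groups — a deep theorem recorded in the tree only
as the named fact `Literature.GroupTheory.NikolovSegalStatement`; Serre's pro-`p` case is PROVED in
`Literature/GroupTheory/ProPStronglyComplete.lean`).  This file records the ELEMENTARY part of the
question "is `G` strongly complete?" RELATIVE to a closed normal subgroup `P ⊴ G` (think: `G = G_k` the
absolute Galois group of a `p`-adic field, `P` its wild inertia subgroup — a free pro-`p` group of
countably infinite rank, so neither Serre's theorem nor the abelian case applies to `P` itself), with
"open in `P`" phrased inside `G` as `∃ V open, V ⊓ P ≤ N`: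

* `isOpen_of_finiteIndex_of_isOpen_inf_normal` — DÉVISSAGE in subgroup form: if every finite-index
  subgroup of `G` containing `P` is open (strong completeness of `G ⧸ P`) and `H ∩ P` contains `V ∩ P` for an
  open subgroup `V`, then the finite-index subgroup `H` is open (cf. the quotient form
  `Literature.GroupTheory.isOpen_of_finiteIndex_of_extension`, seat abc-iut-w5-d218);
* `exists_isOpen_normal_commutator_le` — if `W` acts trivially on the finite quotient `P/N`
  (`⁅W, P⁆ ⊆ N`) and finite-index subgroups above `W` are open, the kernel of the conjugation action of `G`
  on `P/N` is an OPEN normal subgroup `U ⊇ W` with `⁅U, P⁆ ⊆ N`;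
* `exists_isClosed_commutatorClosure_le` — for a finite set `F ⊆ G` and `n`, the subgroup of `P` generated
  by `cl⁅P,P⁆`, the commutators `⁅u, x⁆` (`u ∈ F`, `x ∈ P`) and the `n`-th powers of `P` is CLOSED: modulo
  the closed normal subgroup `D = cl⁅P,P⁆` the group `P/D` is compact ABELIAN, `x ↦ ⁅u,x⁆D` and `q ↦ qⁿ` are
  continuous homomorphisms, and a finite supremum of compact subgroups of an abelian group is compact;
* `commutator_mem_of_dense_of_isClosed` — if a CLOSED subgroup `M` contains `⁅t, x⁆` for all `x ∈ P` and
  all `t` in a set topologically generating `U`, then it contains `⁅u, x⁆` for all `u ∈ U` (the set of such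
  `u` is a closed subgroup: `⁅gh,x⁆ = ⁅g,hxh⁻¹⁆⁅h,x⁆`);
* **`exists_isOpen_inf_le_of_commutatorClosure_le` (the ABELIAN LAYER)** — for `G` compact Hausdorff and
  topologically finitely generated: a `G`-normal finite-index `N ≤ P` containing `cl⁅P,P⁆` is open in `P`,
  PROVIDED the closed subgroup topologically generated by `⁅P, U⁆` and the `[P:N]`-th powers is open in `P`
  for the open normal `U ⊇ P` acting trivially on `P/N` — a Kummer/Iwasawa-type FINITENESS of coinvariants
  («finite `G`-equivariant quotients of `P/cl⁅P,P⁆` are continuous»); this is the case the abelian calculus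
  reaches, and it needs no bounded-generation input;
* **`exists_isOpen_inf_le_of_central_series` / `isOpen_of_finiteIndex_of_central_series`** — the
  reduction along the upper central series: if (a) finite-index subgroups above `P` are open, (b) every
  nontrivial finite `G`-normal quotient `P/N` has a nontrivial centre (automatic for `P` pro-`p`:
  `exists_central_of_proP`), and (c″) for every `G`-normal `P′ ≤ P` open in `P`, every open normal `U ⊇ P`
  and `n ≥ 1` the ABSTRACT subgroup generated by `{⁅x,u⁆ : x ∈ P′, u ∈ U}` and `{yⁿ : y ∈ P′}` is open in
  `P′`, then every `G`-normal finite-index `N ≤ P` is open in `P`, hence (dévissage) EVERY finite-index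
  subgroup of `G` is open; `isOpen_of_finiteIndex_of_proP_normal` is the pro-`p` packaging.

HONEST FRAMING (cell abc-iut, F-1977 / GAP-LEDGER G-L3d2g2-1 neighbourhood; referee note of seat
abc-iut-w4-d069, 2026-08-26T09:52Z, adopted): hypothesis (c″) splits as (c) "the CLOSED subgroup is open"
(a Kummer/local class field theory finiteness at `G_k`) plus (d′) "the abstract subgroup is closed"
(uniform bounded width in the finite quotients) — and (d′) for the wild inertia of a `p`-adic field is of
Nikolov–Segal type (Ann. of Math. 165 (2007), Thm 1.2).  NOTHING of Nikolov–Segal is proved or claimed here;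
this file isolates where it enters.  Classical profinite group theory over Mathlib; no definition, no
instance; nothing here bears on [IUTchIII] Cor. 3.12 or asserts anything about abc.
-/

namespace Literature.GroupTheory

open scoped Pointwise commutatorElement

variable {G : Type*} [Group G] [TopologicalSpace G] [IsTopologicalGroup G]

/-! ### Dévissage in subgroup form -/

/-- **Dévissage (subgroup form).** Let `P ⊴ G` with `G` compact. If every finite-index subgroup of `G`
containing `P` is open (= strong completeness of `G ⧸ P`) and the finite-index subgroup `H` contains
`V ∩ P` for some open subgroup `V` ("`H ∩ P` is open in `P`"), then `H` is open: with `H₂ = H ∩ V`, the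
finite-index subgroup `K = H₂·P ⊇ P` is open and `K ∩ V ⊆ H`. Elementary; the dévissage step of the
strong-completeness discussion of the cited section. [cite: RibesZalesskii2010, §4.2] -/
theorem isOpen_of_finiteIndex_of_isOpen_inf_normal [CompactSpace G] (P : Subgroup G) [P.Normal]
    (hP : ∀ K : Subgroup G, P ≤ K → K.FiniteIndex → IsOpen (K : Set G))
    (H : Subgroup G) [H.FiniteIndex] (V : Subgroup G) (hV : IsOpen (V : Set G)) (hVP : V ⊓ P ≤ H) :
    IsOpen (H : Set G) := by
  haveI : Finite (G ⧸ V) := Subgroup.quotient_finite_of_isOpen V hV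
  haveI : V.FiniteIndex := Subgroup.finiteIndex_of_finite_quotient
  set H₂ : Subgroup G := H ⊓ V with hH₂
  haveI : H₂.FiniteIndex := inferInstance
  set K : Subgroup G := H₂ ⊔ P with hK
  haveI : K.FiniteIndex := Subgroup.finiteIndex_of_le (le_sup_left : H₂ ≤ K)
  have hKopen : IsOpen (K : Set G) := hP K le_sup_right inferInstance
  have hKV : IsOpen ((K ⊓ V : Subgroup G) : Set G) := by
    rw [Subgroup.coe_inf]; exact hKopen.inter hV
  refine Subgroup.isOpen_mono (H₁ := K ⊓ V) ?_ hKV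
  intro x hx
  obtain ⟨hxK, hxV⟩ := Subgroup.mem_inf.mp hx
  have hxK' : x ∈ (K : Set G) := hxK
  rw [hK, Subgroup.mul_normal] at hxK'
  obtain ⟨h, hh, p, hp, rfl⟩ := hxK'
  have hhV : h ∈ V := (inf_le_right : H₂ ≤ V) hh
  have hpV : p ∈ V := by
    have := V.mul_mem (V.inv_mem hhV) hxV
    simpa using this
  exact H.mul_mem ((inf_le_left : H₂ ≤ H) hh) (hVP ⟨hpV, hp⟩)


/-! ### Commutators with a topologically generating set -/

/-- **Commutators with a dense subgroup.** If `M` is a CLOSED subgroup, `P` a normal subgroup and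
`⁅t, x⁆ ∈ M` for all `x ∈ P` and all `t` in a subset `T ⊆ U` generating a dense subgroup of `U`, then
`⁅u, x⁆ ∈ M` for ALL `u ∈ U`, `x ∈ P`: the set `{g | ∀ x ∈ P, ⁅g, x⁆ ∈ M}` is a subgroup
(`⁅gh, x⁆ = ⁅g, hxh⁻¹⁆⁅h, x⁆`, `⁅g⁻¹, x⁆ = ⁅g, g⁻¹xg⁆⁻¹`) and is closed. Elementary topological group
theory (strong-completeness toolkit of the cited section). [cite: RibesZalesskii2010, §4.2] -/
theorem commutator_mem_of_dense_of_isClosed (U P M : Subgroup G) [P.Normal] (hMc : IsClosed (M : Set G))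
    (T : Set U) (hT : Dense ((Subgroup.closure T : Subgroup U) : Set U))
    (hgen : ∀ t ∈ T, ∀ x ∈ P, ⁅(t : G), x⁆ ∈ M) :
    ∀ g ∈ U, ∀ x ∈ P, ⁅g, x⁆ ∈ M := by
  -- the set `S = {g : ∀ x ∈ P, ⁅g, x⁆ ∈ M}` is a closed subgroup of `G`
  let S : Subgroup G :=
    { carrier := {g | ∀ x ∈ P, ⁅g, x⁆ ∈ M}
      mul_mem' := by
        intro g h hg hh x hx
        have key : ⁅g * h, x⁆ = ⁅g, h * x * h⁻¹⁆ * ⁅h, x⁆ := by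
          simp only [commutatorElement_def]; group
        rw [key]
        exact M.mul_mem (hg _ (‹P.Normal›.conj_mem x hx h)) (hh x hx)
      one_mem' := by
        intro x _
        simp
      inv_mem' := by
        intro g hg x hx
        have key : ⁅g⁻¹, x⁆ = (⁅g, g⁻¹ * x * g⁻¹⁻¹⁆)⁻¹ := by
          simp only [commutatorElement_def]; group
        rw [key]
        exact M.inv_mem (hg _ (‹P.Normal›.conj_mem x hx g⁻¹)) }
  have hSc : IsClosed (S : Set G) := by
    have : (S : Set G) = ⋂ x ∈ (P : Set G), (fun g : G => ⁅g, x⁆) ⁻¹' (M : Set G) := by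
      ext g
      simp only [Set.mem_iInter, Set.mem_preimage, SetLike.mem_coe]
      rfl
    rw [this]
    refine isClosed_biInter fun x _ => hMc.preimage ?_
    simp only [commutatorElement_def]
    fun_prop
  -- its trace on `U` is closed and contains the dense subgroup generated by `T`
  have hSU : IsClosed ((S.comap U.subtype : Subgroup U) : Set U) :=
    hSc.preimage continuous_subtype_val
  have hTS : (Subgroup.closure T : Subgroup U) ≤ S.comap U.subtype := by
    rw [Subgroup.closure_le]
    intro t ht x hx
    exact hgen t ht x hx
  have hall : ((S.comap U.subtype : Subgroup U) : Set U) = Set.univ := by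
    apply Set.eq_univ_of_univ_subset
    rw [← hT.closure_eq]
    exact closure_minimal (by exact_mod_cast hTS) hSU
  intro g hg x hx
  have : (⟨g, hg⟩ : U) ∈ ((S.comap U.subtype : Subgroup U) : Set U) := by rw [hall]; trivial
  exact this x hx


/-! ### The closed subgroup generated by `cl⁅P,P⁆`, finitely many commutator maps and `n`-th powers -/

/-- **Compactness modulo the closed commutator subgroup.** Let `P ⊴ G` be closed in the compact group `G`,
`F ⊆ G` finite and `n ∈ ℕ`. There is a CLOSED subgroup `M ≤ P` containing `cl⁅P,P⁆`, every `⁅u, x⁆`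
(`u ∈ F`, `x ∈ P`) and every `yⁿ` (`y ∈ P`), and contained in every subgroup `N ⊆ P` containing `cl⁅P,P⁆`
and these elements. Construction: `P / cl⁅P,P⁆` is a compact Hausdorff ABELIAN group, in which
`x ↦ ⁅u,x⁆` and `q ↦ qⁿ` are continuous homomorphisms; `M` is the preimage of the supremum of their
(compact) ranges, and a finite supremum of compact subgroups of an abelian topological group is compact
(`H ⊔ K = H·K`). Elementary (compact abelian groups; strong-completeness toolkit of the cited section).
[cite: RibesZalesskii2010, §4.2] -/
theorem exists_isClosed_commutatorClosure_le [CompactSpace G] (P : Subgroup G) [hPn : P.Normal]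
    (hPc : IsClosed (P : Set G)) (F : Finset G) (n : ℕ) :
    ∃ M : Subgroup G, IsClosed (M : Set G) ∧ M ≤ P ∧ (⁅P, P⁆).topologicalClosure ≤ M ∧
      (∀ u ∈ F, ∀ x ∈ P, ⁅u, x⁆ ∈ M) ∧ (∀ y ∈ P, y ^ n ∈ M) ∧
      ∀ N : Subgroup G, (⁅P, P⁆).topologicalClosure ≤ N → N ≤ P →
        (∀ u ∈ F, ∀ x ∈ P, ⁅u, x⁆ ∈ N) → (∀ y ∈ P, y ^ n ∈ N) → M ≤ N := by
  classical
  haveI : CompactSpace P := isCompact_iff_compactSpace.mp hPc.isCompact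
  set D : Subgroup G := (⁅P, P⁆).topologicalClosure with hD
  have hDP : D ≤ P := Subgroup.topologicalClosure_minimal _ (Subgroup.commutator_le_left P P) hPc
  haveI hDn : D.Normal := Subgroup.is_normal_topologicalClosure _
  -- the quotient `(P ⧸ D') = P / D` of `P` by the closed normal subgroup `D`
  set D' : Subgroup P := D.subgroupOf P with hD'
  haveI : D'.Normal := hDn.subgroupOf P
  haveI hD'c : IsClosed ((D' : Subgroup P) : Set P) := by
    rw [hD', Subgroup.coe_subgroupOf]
    exact (Subgroup.isClosed_topologicalClosure _).preimage continuous_subtype_val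
  haveI : T2Space (P ⧸ D') := inferInstance
  haveI : CompactSpace (P ⧸ D') := inferInstance
  let π : P →* (P ⧸ D') := QuotientGroup.mk' D'
  have hπc : Continuous π := QuotientGroup.continuous_mk
  -- commutators of elements of `P` lie in `D`
  have hcommD : ∀ x ∈ P, ∀ y ∈ P, ⁅x, y⁆ ∈ D := fun x hx y hy =>
    Subgroup.le_topologicalClosure _ (Subgroup.commutator_mem_commutator hx hy)
  -- `(P ⧸ D')` is commutative
  have hcomm : ∀ a b : (P ⧸ D'), a * b = b * a := by
    intro a b
    induction a using QuotientGroup.induction_on with | H x =>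
    induction b using QuotientGroup.induction_on with | H y =>
    rw [← QuotientGroup.mk_mul, ← QuotientGroup.mk_mul, QuotientGroup.eq, hD', Subgroup.mem_subgroupOf]
    have : (((x * y)⁻¹ * (y * x) : P) : G) = ⁅((y : P) : G)⁻¹, ((x : P) : G)⁻¹⁆ := by
      simp only [commutatorElement_def, Subgroup.coe_mul, Subgroup.coe_inv, inv_inv, mul_inv_rev]
      group
    rw [this]
    exact hcommD _ (P.inv_mem y.2) _ (P.inv_mem x.2)
  -- every subgroup of the commutative group `(P ⧸ D')` is normal
  have hnormal : ∀ K : Subgroup (P ⧸ D'), K.Normal := fun K =>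
    ⟨fun a ha g => by rwa [hcomm g a, mul_inv_cancel_right]⟩
  -- compact subgroups of `(P ⧸ D')` are closed under `⊔`
  have hsupc : ∀ H K : Subgroup (P ⧸ D'), IsCompact (H : Set (P ⧸ D')) → IsCompact (K : Set (P ⧸ D')) →
      IsCompact ((H ⊔ K : Subgroup (P ⧸ D')) : Set (P ⧸ D')) := by
    intro H K hH hK
    haveI := hnormal K
    rw [Subgroup.mul_normal]
    exact hH.mul hK
  -- conjugation-commutator maps `φ_u : P → (P ⧸ D')`, `x ↦ ⁅u, x⁆ D`
  have hmemP : ∀ (u : G) (x : P), ⁅u, (x : G)⁆ ∈ P := fun u x => by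
    rw [commutatorElement_def]
    exact P.mul_mem (hPn.conj_mem _ x.2 u) (P.inv_mem x.2)
  let φ : G → P →* (P ⧸ D') := fun u =>
    { toFun := fun x => π ⟨⁅u, (x : G)⁆, hmemP u x⟩
      map_one' := by
        have h1 : (⟨⁅u, ((1 : P) : G)⁆, hmemP u 1⟩ : P) = 1 := by
          ext; simp [commutatorElement_def]
        rw [h1, map_one]
      map_mul' := by
        intro x y
        rw [← map_mul]
        refine (QuotientGroup.eq).mpr ?_
        rw [hD', Subgroup.mem_subgroupOf]
        have : (((⟨⁅u, ((x * y : P) : G)⁆, hmemP u (x * y)⟩ : P)⁻¹ *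
            (⟨⁅u, (x : G)⁆, hmemP u x⟩ * ⟨⁅u, (y : G)⁆, hmemP u y⟩) : P) : G) =
            ⁅((x : P) : G), (⁅u, ((y : P) : G)⁆)⁻¹⁆ := by
          simp only [commutatorElement_def, Subgroup.coe_mul, Subgroup.coe_inv, mul_inv_rev, inv_inv]
          group
        rw [this]
        exact hcommD _ x.2 _ (P.inv_mem (hmemP u y)) }
  have hφc : ∀ u, Continuous (φ u) := fun u => by
    refine hπc.comp ?_
    refine Continuous.subtype_mk ?_ _
    simp only [commutatorElement_def]
    fun_prop
  have hφ_apply : ∀ u (x : P), φ u x = π ⟨⁅u, (x : G)⁆, hmemP u x⟩ := fun u x => rfl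
  -- the `n`-th power map of the commutative group `(P ⧸ D')`
  let ψ : (P ⧸ D') →* (P ⧸ D') :=
    { toFun := fun q => q ^ n
      map_one' := one_pow n
      map_mul' := fun a b => (show Commute a b from hcomm a b).mul_pow n }
  have hψc : Continuous ψ := continuous_pow n
  have hψ_apply : ∀ q, ψ q = q ^ n := fun q => rfl
  -- the compact subgroup `M_Q = (⨆_{u ∈ F} range φ_u) ⊔ range ψ` of `(P ⧸ D')`
  have hRc : ∀ u, IsCompact (((φ u).range : Subgroup (P ⧸ D')) : Set (P ⧸ D')) := fun u => by
    rw [MonoidHom.coe_range]; exact isCompact_range (hφc u)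
  have hSc : IsCompact ((⨆ u ∈ F, (φ u).range : Subgroup (P ⧸ D')) : Set (P ⧸ D')) := by
    induction F using Finset.induction_on with
    | empty => simp
    | insert a s ha ih =>
      rw [Finset.iSup_insert]
      exact hsupc _ _ (hRc a) ih
  set MQ : Subgroup (P ⧸ D') := (⨆ u ∈ F, (φ u).range) ⊔ ψ.range with hMQ
  have hMQc : IsClosed (MQ : Set (P ⧸ D')) := by
    refine IsCompact.isClosed ?_
    refine hsupc _ _ hSc ?_
    rw [MonoidHom.coe_range]; exact isCompact_range hψc
  -- pull back to `P`, then push into `G`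
  set M' : Subgroup P := MQ.comap π with hM'
  have hM'c : IsClosed (M' : Set P) := by
    rw [hM', Subgroup.coe_comap]; exact hMQc.preimage hπc
  refine ⟨M'.map P.subtype, ?_, ?_, ?_, ?_, ?_, ?_⟩
  · rw [Subgroup.coe_map]
    exact hPc.isClosedEmbedding_subtypeVal.isClosedMap _ hM'c
  · exact Subgroup.map_subtype_le M'
  · intro d hd
    refine ⟨⟨d, hDP hd⟩, ?_, rfl⟩
    change π ⟨d, hDP hd⟩ ∈ MQ
    have : π ⟨d, hDP hd⟩ = 1 := by
      refine (QuotientGroup.eq_one_iff _).mpr ?_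
      rw [hD', Subgroup.mem_subgroupOf]; exact hd
    rw [this]; exact MQ.one_mem
  · intro u hu x hx
    refine ⟨⟨⁅u, x⁆, hmemP u ⟨x, hx⟩⟩, ?_, rfl⟩
    change π ⟨⁅u, x⁆, hmemP u ⟨x, hx⟩⟩ ∈ MQ
    have : π ⟨⁅u, x⁆, hmemP u ⟨x, hx⟩⟩ = φ u ⟨x, hx⟩ := rfl
    rw [this, hMQ]
    refine Subgroup.mem_sup_left ?_
    refine Subgroup.mem_iSup_of_mem u (Subgroup.mem_iSup_of_mem hu ⟨⟨x, hx⟩, rfl⟩)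
  · intro y hy
    refine ⟨⟨y, hy⟩ ^ n, ?_, by simp⟩
    change π (⟨y, hy⟩ ^ n) ∈ MQ
    rw [map_pow, hMQ]
    exact Subgroup.mem_sup_right ⟨π ⟨y, hy⟩, rfl⟩
  · intro N hDN hNP hF hn
    -- `M_Q ≤ π(N ∩ P)`
    set NQ : Subgroup (P ⧸ D') := (N.subgroupOf P).map π with hNQ
    have hMQN : MQ ≤ NQ := by
      rw [hMQ]
      refine sup_le (iSup₂_le fun u hu => ?_) ?_
      · rintro _ ⟨x, rfl⟩
        exact ⟨⟨⁅u, (x : G)⁆, hmemP u x⟩, Subgroup.mem_subgroupOf.mpr (hF u hu x x.2), rfl⟩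
      · rintro _ ⟨q, rfl⟩
        induction q using QuotientGroup.induction_on with | H x =>
        refine ⟨x ^ n, Subgroup.mem_subgroupOf.mpr ?_, ?_⟩
        · simpa using hn x x.2
        · rw [map_pow]; rfl
    have hM'N : M' ≤ N.subgroupOf P := by
      rw [hM']
      refine (Subgroup.comap_mono hMQN).trans ?_
      rw [hNQ, Subgroup.comap_map_eq, QuotientGroup.ker_mk', sup_eq_left.mpr]
      rw [hD']
      exact fun z hz => Subgroup.mem_subgroupOf.mpr (hDN (Subgroup.mem_subgroupOf.mp hz))
    calc M'.map P.subtype ≤ (N.subgroupOf P).map P.subtype := Subgroup.map_mono hM'N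
      _ = N ⊓ P := Subgroup.subgroupOf_map_subtype N P
      _ ≤ N := inf_le_left


/-! ### The kernel of the conjugation action on a finite quotient `P / N` -/

omit [IsTopologicalGroup G] in
/-- **An open normal subgroup acting trivially on `P/N`.** Let `P, N ⊴ G` with `[P : N ∩ P] < ∞`, and let
`W ≤ G` act trivially on `P/N` (`⁅w, x⁆ ∈ N` for `w ∈ W`, `x ∈ P`). If every finite-index subgroup of `G`
containing `W` is open, then the kernel `U` of the conjugation action `G → Perm(P/N)` is an OPEN normal
subgroup containing `W` with `⁅u, x⁆ ∈ N` for all `u ∈ U`, `x ∈ P` (`Perm(P/N)` is finite, so the kernel has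
finite index). Elementary (strong-completeness toolkit of the cited section). [cite: RibesZalesskii2010, §4.2] -/
theorem exists_isOpen_normal_commutator_le (P : Subgroup G) [hPn : P.Normal] (W : Subgroup G)
    (haW : ∀ K : Subgroup G, W ≤ K → K.FiniteIndex → IsOpen (K : Set G))
    (N : Subgroup G) [hNn : N.Normal] (hW : ∀ w ∈ W, ∀ x ∈ P, ⁅w, x⁆ ∈ N)
    (hidx : N.relIndex P ≠ 0) :
    ∃ U : Subgroup G, U.Normal ∧ IsOpen (U : Set G) ∧ W ≤ U ∧ ∀ u ∈ U, ∀ x ∈ P, ⁅u, x⁆ ∈ N := by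
  classical
  set N' : Subgroup P := N.subgroupOf P with hN'
  haveI : N'.Normal := hNn.subgroupOf P
  haveI : N'.FiniteIndex := ⟨hidx⟩
  have hle : ∀ g : G, N' ≤ N'.comap (MulAut.conjNormal g : P ≃* P).toMonoidHom := by
    intro g x hx
    rw [Subgroup.mem_comap, hN', Subgroup.mem_subgroupOf]
    change ((MulAut.conjNormal g x : P) : G) ∈ N
    rw [MulAut.conjNormal_apply]
    exact hNn.conj_mem _ (Subgroup.mem_subgroupOf.mp hx) g
  let f : G → (P ⧸ N' →* P ⧸ N') := fun g =>
    QuotientGroup.map N' N' (MulAut.conjNormal g : P ≃* P).toMonoidHom (hle g)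
  have hf_mk : ∀ (g : G) (x : P), f g (QuotientGroup.mk x) = QuotientGroup.mk (MulAut.conjNormal g x) :=
    fun g x => rfl
  have hf_one : ∀ t, f 1 t = t := by
    intro t
    induction t using QuotientGroup.induction_on with | H x =>
    rw [hf_mk, map_one, MulAut.one_apply]
  have hf_mul : ∀ g h t, f (g * h) t = f g (f h t) := by
    intro g h t
    induction t using QuotientGroup.induction_on with | H x =>
    rw [hf_mk, hf_mk, hf_mk, map_mul, MulAut.mul_apply]
  let ρ : G →* Equiv.Perm (P ⧸ N') :=
    { toFun := fun g =>
        { toFun := f g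
          invFun := f g⁻¹
          left_inv := fun t => by rw [← hf_mul, inv_mul_cancel, hf_one]
          right_inv := fun t => by rw [← hf_mul, mul_inv_cancel, hf_one] }
      map_one' := by ext t; exact hf_one t
      map_mul' := fun g h => by ext t; exact hf_mul g h t }
  have hρ : ∀ g t, ρ g t = f g t := fun g t => rfl
  haveI : Finite (Equiv.Perm (P ⧸ N')) :=
    Finite.of_injective (fun e : Equiv.Perm (P ⧸ N') => (e : P ⧸ N' → P ⧸ N')) DFunLike.coe_injective
  haveI : Finite ρ.range := inferInstance
  haveI : ρ.ker.FiniteIndex := inferInstance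
  -- membership in the kernel, unpacked
  have hker : ∀ g, g ∈ ρ.ker ↔ ∀ x : P, ((MulAut.conjNormal g x : P) : G)⁻¹ * (x : G) ∈ N := by
    intro g
    rw [MonoidHom.mem_ker]
    constructor
    · intro h x
      have := congrArg (fun e : Equiv.Perm (P ⧸ N') => e (QuotientGroup.mk x)) h
      simp only [hρ, hf_mk, Equiv.Perm.coe_one, id_eq] at this
      have := (QuotientGroup.eq).mp this
      rw [hN', Subgroup.mem_subgroupOf] at this
      simpa using this
    · intro h
      ext t
      induction t using QuotientGroup.induction_on with | H x =>
      rw [hρ, hf_mk, Equiv.Perm.coe_one, id_eq]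
      refine (QuotientGroup.eq).mpr ?_
      rw [hN', Subgroup.mem_subgroupOf]
      simpa using h x
  have hWK : W ≤ ρ.ker := by
    intro p hp
    rw [hker]
    intro x
    rw [MulAut.conjNormal_apply]
    have : (p * (x : G) * p⁻¹)⁻¹ * (x : G) = ⁅p, (x : G)⁻¹⁆ := by
      simp only [commutatorElement_def]; group
    rw [this]
    exact hW p hp _ (P.inv_mem x.2)
  refine ⟨ρ.ker, inferInstance, haW _ hWK inferInstance, hWK, ?_⟩
  intro u hu x hx
  have h := (hker u).mp hu ⟨x⁻¹, P.inv_mem hx⟩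
  rw [MulAut.conjNormal_apply] at h
  have : (u * ((⟨x⁻¹, P.inv_mem hx⟩ : P) : G) * u⁻¹)⁻¹ * ((⟨x⁻¹, P.inv_mem hx⟩ : P) : G) = ⁅u, x⁆ := by
    simp only [commutatorElement_def]; group
  rwa [this] at h


/-! ### The abelian layer -/

/-- **The abelian layer: finite `G`-equivariant quotients of `P / cl⁅P,P⁆` are continuous, given finiteness
of coinvariants.** Let `G` be a compact Hausdorff topological group topologically generated by a finite set,
`P ⊴ G` closed such that (a) every finite-index subgroup of `G` containing `P` is open, and `N ⊴ G` with
`cl⁅P,P⁆ ≤ N ≤ P` and `[P : N] < ∞`. Suppose (c): for every open normal `U ⊇ P` acting trivially on `P/N`,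
the CLOSED subgroup topologically generated by `⁅P, U⁆` and the `[P:N]`-th powers of `P` is open in `P`.
Then `N` is open in `P` (`V ∩ P ⊆ N` for an open subgroup `V`). Proof: the kernel `U ⊇ P` of the
`G`-action on `P/N` is open by (a) (`exists_isOpen_normal_commutator_le`), topologically finitely generated
(Schreier, `exists_finset_dense_closure_of_isOpen`) by a finite `F`; the closed subgroup `M ⊆ N` of
`exists_isClosed_commutatorClosure_le` contains `⁅u, x⁆` for ALL `u ∈ U` by
`commutator_mem_of_dense_of_isClosed`, hence the closed subgroup of (c). No bounded-generation input is
used; for `G = G_k` and `P` the wild inertia, (c) is a Kummer/local-class-field-theory finiteness. A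
PARTIAL, elementary case of the cited theorem (which is NOT proved here) under the explicit extra
hypotheses (a), (c). [cite: NikolovSegal2003, Thm 1.1] -/
theorem exists_isOpen_inf_le_of_commutatorClosure_le [CompactSpace G]
    (hfg : ∃ S : Finset G, Dense ((Subgroup.closure (S : Set G) : Subgroup G) : Set G))
    (P : Subgroup G) [hPn : P.Normal] (hPc : IsClosed (P : Set G))
    (ha : ∀ K : Subgroup G, P ≤ K → K.FiniteIndex → IsOpen (K : Set G))
    (N : Subgroup G) [hNn : N.Normal] (hNP : N ≤ P) (hDN : (⁅P, P⁆).topologicalClosure ≤ N)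
    (hidx : N.relIndex P ≠ 0)
    (hc : ∀ U : Subgroup G, U.Normal → IsOpen (U : Set G) → P ≤ U → (∀ u ∈ U, ∀ x ∈ P, ⁅u, x⁆ ∈ N) →
      ∃ V : Subgroup G, IsOpen (V : Set G) ∧
        V ⊓ P ≤ (⁅P, U⁆ ⊔ Subgroup.closure {y | ∃ x ∈ P, x ^ N.relIndex P = y}).topologicalClosure) :
    ∃ V : Subgroup G, IsOpen (V : Set G) ∧ V ⊓ P ≤ N := by
  classical
  -- an open normal `U ⊇ P` with `⁅U, P⁆ ⊆ N`
  obtain ⟨U, hUn, hUo, hPU, hU⟩ := exists_isOpen_normal_commutator_le P P ha N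
    (fun w hw x hx => hDN (Subgroup.le_topologicalClosure _ (Subgroup.commutator_mem_commutator hw hx)))
    hidx
  haveI := hUn
  -- `U` is topologically finitely generated (Schreier)
  obtain ⟨S', hS'⟩ := exists_finset_dense_closure_of_isOpen hfg U hUo
  set F : Finset G := S'.image (fun u : U => (u : G)) with hF
  -- the closed subgroup `M ⊆ N`
  obtain ⟨M, hMc, -, hDM, hFM, hnM, hMmin⟩ := exists_isClosed_commutatorClosure_le P hPc F (N.relIndex P)
  have hMN : M ≤ N := by
    refine hMmin N hDN hNP (fun u hu x hx => ?_) (fun y hy => Subgroup.pow_relIndex_mem N hy)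
    obtain ⟨u', hu', rfl⟩ := Finset.mem_image.mp hu
    exact hU _ u'.2 x hx
  -- `⁅u, x⁆ ∈ M` for ALL `u ∈ U`
  have hall : ∀ g ∈ U, ∀ x ∈ P, ⁅g, x⁆ ∈ M :=
    commutator_mem_of_dense_of_isClosed U P M hMc (S' : Set U) hS'
      (fun t ht x hx => hFM _ (Finset.mem_image_of_mem _ (Finset.mem_coe.mp ht)) x hx)
  -- the closed subgroup of hypothesis (c) lies in `M ⊆ N`
  obtain ⟨V, hVo, hV⟩ := hc U hUn hUo hPU hU
  refine ⟨V, hVo, hV.trans ((Subgroup.topologicalClosure_minimal _ ?_ hMc).trans hMN)⟩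
  refine sup_le ?_ ?_
  · rw [Subgroup.commutator_le]
    intro x hx u hu
    rw [← commutatorElement_inv]
    exact M.inv_mem (hall u hu x hx)
  · rw [Subgroup.closure_le]
    rintro _ ⟨x, hx, rfl⟩
    exact hnM x hx

/-! ### The reduction along the upper central series -/

omit [TopologicalSpace G] [IsTopologicalGroup G] in
/-- **The centre step.** For `P, N ⊴ G`, the subgroup `N₁ = {x ∈ P | ⁅P, x⁆ ⊆ N}` (preimage of the centre
of `P/(N ∩ P)`) is normal in `G`, with `N ∩ P ≤ N₁ ≤ P`. [folklore] -/
private theorem exists_centralStep (P N : Subgroup G) [hPn : P.Normal] [hNn : N.Normal] :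
    ∃ N₁ : Subgroup G, N₁.Normal ∧ N ⊓ P ≤ N₁ ∧ N₁ ≤ P ∧
      (∀ x, x ∈ N₁ ↔ x ∈ P ∧ ∀ y ∈ P, ⁅y, x⁆ ∈ N) := by
  let N₁ : Subgroup G :=
    { carrier := {x | x ∈ P ∧ ∀ y ∈ P, ⁅y, x⁆ ∈ N}
      mul_mem' := by
        rintro a b ⟨haP, ha⟩ ⟨hbP, hb⟩
        refine ⟨P.mul_mem haP hbP, fun y hy => ?_⟩
        have key : ⁅y, a * b⁆ = ⁅y, a⁆ * (a * ⁅y, b⁆ * a⁻¹) := by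
          simp only [commutatorElement_def]; group
        rw [key]
        exact N.mul_mem (ha y hy) (hNn.conj_mem _ (hb y hy) a)
      one_mem' := ⟨P.one_mem, fun y _ => by simp⟩
      inv_mem' := by
        rintro a ⟨haP, ha⟩
        refine ⟨P.inv_mem haP, fun y hy => ?_⟩
        have key : ⁅y, a⁻¹⁆ = a⁻¹ * (⁅y, a⁆)⁻¹ * a⁻¹⁻¹ := by
          simp only [commutatorElement_def]; group
        rw [key]
        exact hNn.conj_mem _ (N.inv_mem (ha y hy)) a⁻¹ }
  refine ⟨N₁, ?_, ?_, fun x hx => hx.1, fun x => Iff.rfl⟩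
  · refine ⟨fun a ha g => ⟨hPn.conj_mem _ ha.1 g, fun y hy => ?_⟩⟩
    have key : ⁅y, g * a * g⁻¹⁆ = g * ⁅g⁻¹ * y * g⁻¹⁻¹, a⁆ * g⁻¹ := by
      simp only [commutatorElement_def]; group
    rw [key]
    exact hNn.conj_mem _ (ha.2 _ (hPn.conj_mem _ hy g⁻¹)) g
  · rintro x ⟨hxN, hxP⟩
    refine ⟨hxP, fun y hy => ?_⟩
    rw [commutatorElement_def]
    exact N.mul_mem (hNn.conj_mem _ hxN y) (N.inv_mem hxN)

omit [IsTopologicalGroup G] in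
/-- **Reduction along the upper central series.** Let `P ⊴ G` with (a) every finite-index subgroup of `G`
containing `P` open; (b) every `G`-normal `N < P` of finite index admits `z ∈ P ∖ N` with `⁅P, z⁆ ⊆ N`
(nontrivial centre of `P/N` — automatic for `P` pro-`p`, `exists_central_of_proP`); (c″) for every
`G`-normal `P′ ≤ P` open in `P`, every open normal `U ⊇ P` and `n ≥ 1`, the ABSTRACT subgroup generated by
`{⁅x, u⁆ : x ∈ P′, u ∈ U}` and `{yⁿ : y ∈ P′}` is open in `P′`. Then every `G`-normal `N ≤ P` of finite
index `n ≥ 1` is open in `P`. Induction on `[P : N]`: the centre step `N₁ ⊋ N` is open in `P` by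
induction, the kernel `U ⊇ P` of the `G`-action on the central layer `N₁/N` is open by (a), and
`N ⊇ ⟨⁅N₁, U⁆, N₁^{[N₁:N]}⟩`, open in `N₁` by (c″). HONEST NOTE: (c″) = "the closed subgroup is open"
(finiteness of coinvariants) + "the abstract subgroup is closed" (uniform bounded width); the latter is
the Nikolov–Segal-type input for an infinitely generated `P` and is NOT proved here. A REDUCTION of the
cited theorem (which is NOT proved here) to the explicit hypotheses (a), (b), (c″).
[cite: NikolovSegal2003, Thm 1.1] -/
theorem exists_isOpen_inf_le_of_central_series (P : Subgroup G) [hPn : P.Normal]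
    (ha : ∀ K : Subgroup G, P ≤ K → K.FiniteIndex → IsOpen (K : Set G))
    (hb : ∀ N : Subgroup G, N.Normal → N ≤ P → N.relIndex P ≠ 0 → N ≠ P →
      ∃ z ∈ P, z ∉ N ∧ ∀ y ∈ P, ⁅y, z⁆ ∈ N)
    (hc : ∀ P' U : Subgroup G, P'.Normal → U.Normal → P' ≤ P →
      (∃ V : Subgroup G, IsOpen (V : Set G) ∧ V ⊓ P ≤ P') → IsOpen (U : Set G) → P ≤ U →
      ∀ n : ℕ, n ≠ 0 → ∃ V : Subgroup G, IsOpen (V : Set G) ∧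
        V ⊓ P' ≤ ⁅P', U⁆ ⊔ Subgroup.closure {y | ∃ x ∈ P', x ^ n = y}) (n : ℕ) :
    ∀ N : Subgroup G, N.Normal → N ≤ P → N.relIndex P = n → n ≠ 0 →
      ∃ V : Subgroup G, IsOpen (V : Set G) ∧ V ⊓ P ≤ N := by
  induction n using Nat.strong_induction_on with | _ n ih => ?_
  intro N hNn hNP hNidx hn0
  by_cases hNeq : N = P
  · exact ⟨⊤, isOpen_univ, by rw [hNeq]; exact inf_le_right⟩
  -- the centre step `N₁ ⊋ N`
  obtain ⟨z, hzP, hzN, hz⟩ := hb N hNn hNP (hNidx ▸ hn0) hNeq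
  obtain ⟨N₁, hN₁n, hNN₁, hN₁P, hN₁⟩ := exists_centralStep P N
  have hNN₁' : N ≤ N₁ := fun x hx => hNN₁ ⟨hx, hNP hx⟩
  have hzN₁ : z ∈ N₁ := (hN₁ z).mpr ⟨hzP, hz⟩
  -- indices
  have hmul : N.relIndex N₁ * N₁.relIndex P = n := by
    rw [← hNidx]; exact Subgroup.relIndex_mul_relIndex N N₁ P hNN₁' hN₁P
  have h1 : N.relIndex N₁ ≠ 1 := by
    rw [Ne, Subgroup.relIndex_eq_one]
    exact fun h => hzN (h hzN₁)
  have h0 : N.relIndex N₁ ≠ 0 := fun h => hn0 (by rw [← hmul, h, zero_mul])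
  have h0' : N₁.relIndex P ≠ 0 := fun h => hn0 (by rw [← hmul, h, mul_zero])
  have hlt : N₁.relIndex P < n := by
    rw [← hmul]
    have h2 : 2 ≤ N.relIndex N₁ := by omega
    calc N₁.relIndex P = 1 * N₁.relIndex P := (one_mul _).symm
      _ < N.relIndex N₁ * N₁.relIndex P := Nat.mul_lt_mul_of_pos_right (by omega) (by omega)
  -- `N₁` is open in `P` by induction
  obtain ⟨V₁, hV₁o, hV₁⟩ := ih _ hlt N₁ hN₁n hN₁P rfl h0'
  -- an open normal `U ⊇ P` acting trivially on `N₁ / N`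
  haveI := hN₁n
  obtain ⟨U, hUn, hUo, hPU, hU⟩ := exists_isOpen_normal_commutator_le N₁ P ha N
    (fun w hw x hx => ((hN₁ x).mp hx).2 w hw) h0
  -- hypothesis (c'') at `P' = N₁`
  obtain ⟨V, hVo, hV⟩ := hc N₁ U hN₁n hUn hN₁P ⟨V₁, hV₁o, hV₁⟩ hUo hPU (N.relIndex N₁) h0
  refine ⟨V ⊓ V₁, ?_, ?_⟩
  · rw [Subgroup.coe_inf]; exact hVo.inter hV₁o
  · intro x hx
    obtain ⟨⟨hxV, hxV₁⟩, hxP⟩ := Subgroup.mem_inf.mp hx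
    have hxN₁ : x ∈ N₁ := hV₁ ⟨hxV₁, hxP⟩
    have hx' : x ∈ ⁅N₁, U⁆ ⊔ Subgroup.closure {y | ∃ x ∈ N₁, x ^ N.relIndex N₁ = y} := hV ⟨hxV, hxN₁⟩
    refine (sup_le ?_ ?_ : ⁅N₁, U⁆ ⊔ Subgroup.closure {y | ∃ x ∈ N₁, x ^ N.relIndex N₁ = y} ≤ N) hx'
    · rw [Subgroup.commutator_le]
      intro a ha u hu
      rw [← commutatorElement_inv]
      exact N.inv_mem (hU u hu a ha)
    · rw [Subgroup.closure_le]
      rintro _ ⟨y, hy, rfl⟩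
      exact Subgroup.pow_relIndex_mem N hy


/-- **Strong completeness from the central-series reduction.** Under (a), (b), (c″) of
`exists_isOpen_inf_le_of_central_series` for a normal subgroup `P` of the compact group `G`, EVERY
finite-index subgroup `H` of `G` is open: apply the reduction to the `G`-normal subgroup
`H.normalCore ∩ P ≤ P` and conclude by dévissage (`isOpen_of_finiteIndex_of_isOpen_inf_normal`). A
REDUCTION of the cited theorem (NOT proved here) to the explicit hypotheses (a), (b), (c″).
[cite: NikolovSegal2003, Thm 1.1] -/
theorem isOpen_of_finiteIndex_of_central_series [CompactSpace G] (P : Subgroup G) [hPn : P.Normal]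
    (ha : ∀ K : Subgroup G, P ≤ K → K.FiniteIndex → IsOpen (K : Set G))
    (hb : ∀ N : Subgroup G, N.Normal → N ≤ P → N.relIndex P ≠ 0 → N ≠ P →
      ∃ z ∈ P, z ∉ N ∧ ∀ y ∈ P, ⁅y, z⁆ ∈ N)
    (hc : ∀ P' U : Subgroup G, P'.Normal → U.Normal → P' ≤ P →
      (∃ V : Subgroup G, IsOpen (V : Set G) ∧ V ⊓ P ≤ P') → IsOpen (U : Set G) → P ≤ U →
      ∀ n : ℕ, n ≠ 0 → ∃ V : Subgroup G, IsOpen (V : Set G) ∧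
        V ⊓ P' ≤ ⁅P', U⁆ ⊔ Subgroup.closure {y | ∃ x ∈ P', x ^ n = y})
    (H : Subgroup G) [H.FiniteIndex] : IsOpen (H : Set G) := by
  set N : Subgroup G := H.normalCore ⊓ P with hN
  haveI : N.Normal := inferInstance
  have hNP : N ≤ P := inf_le_right
  have hidx : N.relIndex P ≠ 0 := by
    rw [hN, Subgroup.inf_relIndex_right]
    exact (Subgroup.FiniteIndex.index_ne_zero (H := H.normalCore.subgroupOf P))
  obtain ⟨V, hVo, hV⟩ := exists_isOpen_inf_le_of_central_series P ha hb hc (N.relIndex P) N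
    inferInstance hNP rfl hidx
  exact isOpen_of_finiteIndex_of_isOpen_inf_normal P ha H V hVo
    (hV.trans ((inf_le_left : N ≤ H.normalCore).trans H.normalCore_le))

/-! ### The pro-`p` packaging -/

omit [IsTopologicalGroup G] in
/-- **Hypothesis (b) for a pro-`p` subgroup.** If the closed normal subgroup `P` of the profinite group `G`
is pro-`p` (all its open normal quotients are `p`-groups), then every `G`-normal `N` of finite index in
`P` with `¬ P ≤ N` admits `z ∈ P ∖ N` with `⁅P, z⁆ ⊆ N`: the ABSTRACT finite quotient `P/(N ∩ P)` is a
`p`-group (`isPGroup_quotient_of_finiteIndex_of_proP`, seat abc-iut-w5-d218), hence has nontrivial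
centre (first step of Serre's theorem in the cited reference). [cite: DDMSAnalyticProP1999, Thm 1.17] -/
theorem exists_central_of_proP [CompactSpace G] [TotallyDisconnectedSpace G] [IsTopologicalGroup G]
    {p : ℕ} [Fact p.Prime] (P : Subgroup G) (hPc : IsClosed (P : Set G))
    (hP : ∀ U : OpenNormalSubgroup P, IsPGroup p (P ⧸ (U : Subgroup P)))
    (N : Subgroup G) [hNn : N.Normal] (hidx : N.relIndex P ≠ 0) (hNe : ¬ P ≤ N) :
    ∃ z ∈ P, z ∉ N ∧ ∀ y ∈ P, ⁅y, z⁆ ∈ N := by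
  haveI : CompactSpace P := isCompact_iff_compactSpace.mp hPc.isCompact
  set N' : Subgroup P := N.subgroupOf P with hN'
  haveI : N'.Normal := hNn.subgroupOf P
  haveI : N'.FiniteIndex := ⟨hidx⟩
  have hQ : IsPGroup p (P ⧸ N') := isPGroup_quotient_of_finiteIndex_of_proP hP N'
  haveI : Finite (P ⧸ N') := Subgroup.finite_quotient_of_finiteIndex
  -- the quotient is nontrivial
  haveI : Nontrivial (P ⧸ N') := by
    obtain ⟨x, hxP, hxN⟩ := Set.not_subset.mp hNe
    refine ⟨⟨QuotientGroup.mk ⟨x, hxP⟩, 1, fun h => hxN ?_⟩⟩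
    have := (QuotientGroup.eq_one_iff _).mp h
    rw [hN', Subgroup.mem_subgroupOf] at this
    exact this
  haveI := hQ.center_nontrivial
  obtain ⟨⟨c, hc⟩, hc1⟩ := exists_ne (1 : Subgroup.center (P ⧸ N'))
  induction c using QuotientGroup.induction_on with | H z =>
  refine ⟨z, z.2, fun hzN => hc1 ?_, fun y hy => ?_⟩
  · ext
    change (QuotientGroup.mk z : P ⧸ N') = 1
    rw [QuotientGroup.eq_one_iff, hN', Subgroup.mem_subgroupOf]
    exact hzN
  · have hcomm := Subgroup.mem_center_iff.mp hc (QuotientGroup.mk ⟨y, hy⟩)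
    rw [← QuotientGroup.mk_mul, ← QuotientGroup.mk_mul, QuotientGroup.eq, hN',
      Subgroup.mem_subgroupOf] at hcomm
    have : (((⟨y, hy⟩ * z)⁻¹ * (z * ⟨y, hy⟩) : P) : G) = ⁅((z : P) : G)⁻¹, y⁻¹⁆ := by
      simp only [commutatorElement_def, Subgroup.coe_mul, Subgroup.coe_inv, mul_inv_rev, inv_inv]
      group
    rw [this] at hcomm
    have key : ⁅y, ((z : P) : G)⁆ = ((y * (z : G)) * ⁅((z : P) : G)⁻¹, y⁻¹⁆ * (y * (z : G))⁻¹)⁻¹ := by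
      simp only [commutatorElement_def]; group
    rw [key]
    exact N.inv_mem (hNn.conj_mem _ hcomm _)

/-- **Strong completeness of `G` from a pro-`p` normal subgroup, modulo (a) and (c″).** Let `G` be
profinite and `P ⊴ G` a closed normal PRO-`p` subgroup such that (a) every finite-index subgroup of `G`
containing `P` is open (strong completeness of `G ⧸ P`) and (c″) for every `G`-normal `P′ ≤ P` open in `P`,
every open normal `U ⊇ P` and `n ≥ 1`, the abstract subgroup generated by `{⁅x, u⁆ : x ∈ P′, u ∈ U}` and
`{yⁿ : y ∈ P′}` is open in `P′`. Then every finite-index subgroup of `G` is open. For `G = G_k`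
(`k`/`ℚ_p` finite) and `P` the wild inertia: (a) is elementary (the tame quotient is
procyclic-by-procyclic) and (c″) = Kummer-type finiteness + a Nikolov–Segal-type closedness — the latter
is NOT claimed here. A REDUCTION of the cited theorem (NOT proved here) to (a), (c″) for pro-`p` `P`.
[cite: NikolovSegal2003, Thm 1.1] -/
theorem isOpen_of_finiteIndex_of_proP_normal [CompactSpace G] [TotallyDisconnectedSpace G]
    {p : ℕ} [Fact p.Prime] (P : Subgroup G) [hPn : P.Normal] (hPc : IsClosed (P : Set G))
    (hP : ∀ U : OpenNormalSubgroup P, IsPGroup p (P ⧸ (U : Subgroup P)))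
    (ha : ∀ K : Subgroup G, P ≤ K → K.FiniteIndex → IsOpen (K : Set G))
    (hc : ∀ P' U : Subgroup G, P'.Normal → U.Normal → P' ≤ P →
      (∃ V : Subgroup G, IsOpen (V : Set G) ∧ V ⊓ P ≤ P') → IsOpen (U : Set G) → P ≤ U →
      ∀ n : ℕ, n ≠ 0 → ∃ V : Subgroup G, IsOpen (V : Set G) ∧
        V ⊓ P' ≤ ⁅P', U⁆ ⊔ Subgroup.closure {y | ∃ x ∈ P', x ^ n = y})
    (H : Subgroup G) [H.FiniteIndex] : IsOpen (H : Set G) :=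
  isOpen_of_finiteIndex_of_central_series P ha
    (fun N hNn hNP hidx hne => by
      haveI := hNn
      exact exists_central_of_proP P hPc hP N hidx (fun h => hne (le_antisymm hNP h)))
    hc H

end Literature.GroupTheory
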